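import Mathlib
import Literature.RepresentationTheory.FiniteGroups.CharacterCentre
import Literature.RepresentationTheory.FiniteGroups.WedderburnBlocks
import HarnessLib

/-!
# `d² ≤ |G : Z(G)|` for every irreducible character degree `d` (Isaacs, Cor. 2.30 with Cor. 2.28)

Topic `Literature/RepresentationTheory/FiniteGroups`, namespace `Literature.RepresentationTheory.FiniteGroups`;
a corollary file of `CharacterCentre.lean`, which PROVES Isaacs' Cor. 2.28 (`Z(G) ⊆ Z(χ)`,
`Representation.center_le_centre`) and Cor. 2.30 (`χ(1)² ≤ |G : Z(χ)|`,
`Representation.finrank_sq_le_index_centre`).  Combining the two gives the form in which the bound is used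
to control the largest character degree of a group with a large centre (e.g. `p`-groups of class `2`):

* `charDegree_sq_le_index_center` — `d ∈ charDegrees G ⇒ d² ≤ |G : Z(G)|`;
* `maxCharDegree_sq_le_index_center` — `d_max(G)² ≤ |G : Z(G)|` (finite `G`);
* `maxCharDegree_le_sqrt_index_center` — `d_max(G) ≤ ⌊√|G : Z(G)|⌋` (`Nat.sqrt`).

Source: I. M. Isaacs, *Character Theory of Finite Groups*, Academic Press 1976, Cor. 2.28 and Cor. 2.30
(p. 27–28: "(2.30) COROLLARY Let `χ ∈ Irr(G)`. Then `χ(1)² ≤ |G : Z(χ)|`"; with `Z(G) ⊆ Z(χ)` from 2.28).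
Everything here is proved; no definition, no named fact.  (Requested by the cell `mm-stpp`, CENSUS-PLAN §7
S4, for the degree bound of class-2 2-groups in the `d`-row certificates.)
-/

noncomputable section

namespace Literature.RepresentationTheory.FiniteGroups

open Module

variable {G : Type} [Group G] [Fintype G]

/-- **`d² ≤ |G : Z(G)|` for every character degree `d`** (Isaacs Cor. 2.30 `χ(1)² ≤ |G : Z(χ)|` and
Cor. 2.28 `Z(G) ⊆ Z(χ)`, so `|G : Z(χ)| ≤ |G : Z(G)|`). [cite: Isaacs1976, Cor. 2.30] -/
theorem charDegree_sq_le_index_center {d : ℕ} (hd : d ∈ charDegrees G) :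
    d ^ 2 ≤ (Subgroup.center G).index := by
  obtain ⟨V, _, _, _, ρ, hρ, rfl⟩ := hd
  haveI := hρ
  exact (Representation.finrank_sq_le_index_centre ρ).trans
    (Subgroup.index_antitone (Representation.center_le_centre ρ))

/-- **`d_max(G)² ≤ |G : Z(G)|`** for a finite group. [cite: Isaacs1976, Cor. 2.30] -/
theorem maxCharDegree_sq_le_index_center : maxCharDegree G ^ 2 ≤ (Subgroup.center G).index := by
  have hne : (charDegrees G).Nonempty := charDegrees_nonempty
  have hbdd : BddAbove (charDegrees G) := bddAbove_charDegrees' G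
  obtain ⟨d, hd, hmax⟩ : ∃ d ∈ charDegrees G, maxCharDegree G = d :=
    ⟨sSup (charDegrees G), Nat.sSup_mem hne hbdd, rfl⟩
  rw [hmax]
  exact charDegree_sq_le_index_center hd

/-- **`d_max(G) ≤ ⌊√|G : Z(G)|⌋`** (integer square root). [cite: Isaacs1976, Cor. 2.30] -/
theorem maxCharDegree_le_sqrt_index_center : maxCharDegree G ≤ Nat.sqrt (Subgroup.center G).index := by
  rw [Nat.le_sqrt, ← pow_two]
  exact maxCharDegree_sq_le_index_center

end Literature.RepresentationTheory.FiniteGroups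

end
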